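import Summits.FinalStateConjecture.FinalStateConjecture.Theses.StarvedNecks
import Literature.Geometry.Lorentzian.TrivialDataAdmissible

/-!
# `HonestFixedRadiusSettling` (crux `stmt-FinalStateConjecture-13550`, route `StarvedNecks`):
# kill shape, load-bearing parameters, WCC content and existential content (negative-side support)

Support file of the crux disprover (cdisprove seat). The crux asserts, for every connected Hausdorff
second countable `3`-manifold `Σ`, Christodoulou-genericity (codimension `≥ 1`, curve form,
relative to `admissibleVacuumData Σ`) of the property `P D`: an MGHD exists, and every MGHD has
complete `𝓘⁺` (sojourn form) and carries, on its self-determined exterior `O = J⁺(ιΣ) ∩ I⁻(charts)`,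
a `C⁴` `FinalStateDecomposition` which is HONEST (`HonestCore ∧ HonestFar`, the crux's let-bound
clauses C1–C4, F1–F3). Proved here, `sorry`-free, axioms `propext · Classical.choice · Quot.sound`:

* §0 read-back: `honestCoreSet`, `honestFarSet`, `honestDevelopments`, `settlingSet` (verbatim,
  as SETS) and `crux_iff` (`Iff.rfl`): no coercion or junk operator sits between text and `Prop`.
* §1 SHAPE OF ANY KILL: `not_isChristodoulouGeneric_iff`; `not_crux_of_forall_not(_slice)` — a
  refutation must exhibit an admissible datum through which EVERY smooth admissible curve meets the
  exceptional set again; since `IsSmoothDataFamily` is only local joint smoothness (a curve may be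
  modified at distance `1/c`), in practice `P` must fail on a whole nonempty admissible class.
* §2 LOAD-BEARING PARAMETER: `codim_zero` — with codimension `0` the statement is free, so the `1`
  carries all the content; `isChristodoulouGeneric_one_of_succ` / `not_codim_succ_of_not_crux` —
  codimension is monotone (restrict families to an axis, `axisEmbed`), so the crux is the WEAKEST
  positive-codimension version; `crux_false_of_not_wcc` — the crux contains the typed weak cosmic
  censorship statement (genericity of `censoredSet`; verbatim the route items
  `PhaseMixingCapture.WeakCosmicCensorshipMGHD` / `LapseTrumpetKID.WeakCosmicCensorship`), so any
  disproof of WCC kills it.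
* §3 `honestCoreSet_mono`, `honestFarSet_mono` (WLOG `R₀` large); `mem_honestCoreSet_iff_of_N_eq_zero`,
  `mem_honestFarSet_iff_of_N_eq_zero` (with no hole every hole clause is vacuous).
* `exists_isMaximal_of_crux` — the crux's existential content (every proof must produce an MGHD
  of some admissible datum on `ℝ³` which is honest; no maximality theorem is in the tree).

The CONSISTENCY WITNESS (the Minkowski development of the trivial data lies in
`honestDevelopments trivialData`: every clause of `P` holds there, so the clauses are jointly
satisfiable and the universal-failure kill route is closed modulo maximality) is the companion file
`Negative/MinkowskiWitness.lean`.
-/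

noncomputable section

open Literature.Geometry.Lorentzian
open scoped Manifold ContDiff ENNReal Topology
open Filter Set TopologicalSpace

namespace Summit.FinalStateConjecture.FinalStateConjecture.Theorems.HonestFixedRadiusSettling.Negative

open Summit.FinalStateConjecture.FinalStateConjecture.Theses.StarvedNecks (HonestFixedRadiusSettling)

/-! ### §0 Read-back of the crux -/

/-- The decompositions satisfying the crux's `HonestCore` clauses (verbatim the let-bound `Hc`):
sub-extremal holes with `100 Mᵢ ≤ R₀` and orthochronous boosts (C1); anchoring at every radius
`≥ R₀` (C2); relative closedness in `O` of late tube portions for every continuous radius profile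
(C3); future-oriented flat chart (C4). -/
def honestCoreSet (𝓢 : Spacetime.{0} 4) (O : Set 𝓢.carrier) (k : ℕ) (R₀ : ℝ) :
    Set (FinalStateDecomposition 𝓢 O k) :=
  {d | let B := d.background; let t := fun i ↦ (B i).time; let r := fun i ↦ (B i).radius;
    let Ψ := d.chart;
    (∀ i, Kerr.IsSubextremal (d.mass i) (d.spin i) ∧ 100 * d.mass i ≤ R₀ ∧
        0 < ((d.motion i).1 : E4 ≃L[ℝ] E4) (E4.basisVector 0) 0) ∧
    (∀ i (ϱ τ₂ : ℝ), R₀ ≤ ϱ → d.τ₀ < τ₂ →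
        Ψ i '' {x | d.τ₀ < t i x.1 ∧ t i x.1 < τ₂ ∧ r i x.1 < ϱ} ⊆
          𝓢.metric.causalPast 𝓢.timeOrientation (Ψ i '' (B i).truncTimeSlab ϱ τ₂)) ∧
    (∀ i (τ' : ℝ) (ϱ : ℝ → ℝ), Continuous ϱ → d.τ₀ < τ' →
        let A := Ψ i '' {x | τ' ≤ t i x.1 ∧ r i x.1 ≤ ϱ (t i x.1)}; closure A ∩ O ⊆ A) ∧
    (∀ y : d.flatDomain, d.τ₀ < y.1 0 →
        𝓢.timeOrientation.IsFutureDirected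
          (mfderiv 𝓘(ℝ, E4) (𝓡 4) d.flatChart y (E4.basisVector 0)))}

/-- The decompositions satisfying the crux's `HonestFar` clauses (verbatim the let-bound `Hf`):
flat-late points below later flat slabs (F1); closures of far flat slabs are flat points (F2); each
hole chart eventually `C⁰`-close (`1/(10‖Λᵢ‖²)`) to its boosted Kerr on its own Voronoi cell beyond
`R₀` (F3). -/
def honestFarSet (𝓢 : Spacetime.{0} 4) (O : Set 𝓢.carrier) (k : ℕ) (R₀ : ℝ) :
    Set (FinalStateDecomposition 𝓢 O k) :=
  {d | let B := d.background; let t := fun i ↦ (B i).time; let r := fun i ↦ (B i).radius;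
    let Φ := d.flatChart;
    (∀ τ₂ : ℝ, d.τ₀ < τ₂ → Φ '' {y | d.τ₀ < y.1 0 ∧ y.1 0 < τ₂} ⊆
        𝓢.metric.causalPast 𝓢.timeOrientation
          (Φ '' (Minkowski.backgroundOn d.flatDomain).timeSlab τ₂)) ∧
    (∀ τ' : ℝ, d.τ₀ < τ' →
        closure (Φ '' {y | τ' ≤ y.1 0 ∧ ∀ i, d.excision i (y.1 0) + 1 ≤ r i y.1}) ⊆
          Φ '' {y | τ' ≤ y.1 0}) ∧
    (∀ i, ∃ T : ℝ, supCkENorm (Subtype.val '' {x : (B i).domain | T ≤ t i x.1 ∧ R₀ ≤ r i x.1 ∧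
        ∀ j, j ≠ i → r i x.1 ≤ r j x.1}) 0 (𝓢.deviationExtend (B i) (d.chart i)) ≤
          ENNReal.ofReal (1 / (10 * ‖(((d.motion i).1 : E4 ≃L[ℝ] E4) : E4 →L[ℝ] E4)‖ ^ 2)))}

section Pointwise

variable {X : Type} [TopologicalSpace X] [ChartedSpace E3 X] [IsManifold (𝓡 3) ∞ X]
  [ConnectedSpace X]

/-- The vacuum Cauchy developments of `D` at which the second conjunct of `P` holds: complete `𝓘⁺`
and an honest `C⁴` decomposition of the self-determined exterior. -/
def honestDevelopments (D : InitialDataSet (𝓡 3) X) : Set (VacuumCauchyDevelopment D) :=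
  {𝒟 | HasCompleteNullInfinity 𝒟.toCauchyDevelopment ∧
    ∃ (O : Set 𝒟.carrier) (d : FinalStateDecomposition 𝒟.toSpacetime O 4) (R₀ : ℝ),
      O = exteriorOf 𝒟.toCauchyDevelopment d.charted ∧
        d ∈ honestCoreSet 𝒟.toSpacetime O 4 R₀ ∧ d ∈ honestFarSet 𝒟.toSpacetime O 4 R₀}

variable (X) in
/-- The property `P` of the crux, as a set of data: an MGHD exists and every MGHD is honest. -/
def settlingSet : Set (InitialDataSet (𝓡 3) X) :=
  {D | (∃ 𝒟 : VacuumCauchyDevelopment D, 𝒟.IsMaximal) ∧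
    ∀ 𝒟 : VacuumCauchyDevelopment D, 𝒟.IsMaximal → 𝒟 ∈ honestDevelopments D}

variable (X) in
/-- The weak-cosmic-censorship part of `P`: an MGHD exists and every MGHD has complete `𝓘⁺`. -/
def censoredSet : Set (InitialDataSet (𝓡 3) X) :=
  {D | (∃ 𝒟 : VacuumCauchyDevelopment D, 𝒟.IsMaximal) ∧
    ∀ 𝒟 : VacuumCauchyDevelopment D, 𝒟.IsMaximal → HasCompleteNullInfinity 𝒟.toCauchyDevelopment}

/-- `P` implies its WCC part, pointwise. -/
theorem settlingSet_subset_censoredSet : settlingSet X ⊆ censoredSet X :=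
  fun _ h ↦ ⟨h.1, fun 𝒟 h𝒟 ↦ (h.2 𝒟 h𝒟).1⟩

end Pointwise

/-- **Read-back.** The crux is, for every `Σ`, Christodoulou-genericity with codimension `1` of
membership in `settlingSet Σ` — by `Iff.rfl` (the let-bound clauses zeta-reduce to the sets above). -/
theorem crux_iff :
    HonestFixedRadiusSettling ↔ ∀ (X : Type) [TopologicalSpace X] [ChartedSpace E3 X]
      [IsManifold (𝓡 3) ∞ X] [T2Space X] [SecondCountableTopology X] [ConnectedSpace X],
      InitialDataSet.IsChristodoulouGeneric (admissibleVacuumData X) (· ∈ settlingSet X) 1 :=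
  Iff.rfl

/-! ### §1 Shape of any kill -/

section Genericity

variable {E : Type*} [NormedAddCommGroup E] [NormedSpace ℝ E] {H : Type*} [TopologicalSpace H]
  {I : ModelWithCorners ℝ E H} {Y : Type*} [TopologicalSpace Y] [ChartedSpace H Y]
  [IsManifold I ∞ Y]

/-- Failure of Christodoulou genericity, unfolded: an exceptional datum through which every smooth
injective admissible `m`-parameter family has another exceptional member. -/
theorem not_isChristodoulouGeneric_iff (𝓓 : Set (InitialDataSet I Y)) (P : InitialDataSet I Y → Prop)
    (m : ℕ) :
    ¬ InitialDataSet.IsChristodoulouGeneric 𝓓 P m ↔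
      ∃ d ∈ 𝓓, ¬ P d ∧ ∀ F : EuclideanSpace ℝ (Fin m) → InitialDataSet I Y,
        InitialDataSet.IsSmoothDataFamily m F → F 0 = d → Function.Injective F → (∀ c, F c ∈ 𝓓) →
          ∃ c ≠ 0, ¬ P (F c) := by
  constructor
  · intro h
    by_contra hcon
    apply h
    intro d hd
    by_contra hF
    apply hcon
    refine ⟨d, hd.1, hd.2, fun F hF0 h0 hinj hmem ↦ ?_⟩
    by_contra hc
    push Not at hc
    exact hF ⟨F, hF0, h0, hinj, hmem, fun c hc' hE ↦ hE.2 (hc c hc')⟩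
  · rintro ⟨d, hd, hP, h⟩ hgen
    obtain ⟨F, hF, h0, hinj, hmem, hE⟩ := hgen d ⟨hd, hP⟩
    obtain ⟨c, hc, hPc⟩ := h F hF h0 hinj hmem
    exact hE c hc ⟨hmem c, hPc⟩

/-- A nonzero parameter exists in `ℝᵐ` as soon as `0 < m`. -/
theorem exists_ne_zero_euclideanSpace {m : ℕ} (hm : 0 < m) : ∃ c : EuclideanSpace ℝ (Fin m), c ≠ 0 := by
  refine ⟨EuclideanSpace.single ⟨0, hm⟩ 1, fun h ↦ ?_⟩
  have := congrArg (fun v : EuclideanSpace ℝ (Fin m) ↦ v ⟨0, hm⟩) h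
  simp at this

/-- Sufficient kill shape: a nonempty admissible class on which `P` fails everywhere is not
Christodoulou-generic in any positive codimension. -/
theorem not_isChristodoulouGeneric_of_forall_not {𝓓 : Set (InitialDataSet I Y)}
    {P : InitialDataSet I Y → Prop} {m : ℕ} (hm : 0 < m) (hne : 𝓓.Nonempty)
    (h : ∀ d ∈ 𝓓, ¬ P d) : ¬ InitialDataSet.IsChristodoulouGeneric 𝓓 P m := by
  intro hgen
  obtain ⟨d, hd⟩ := hne
  obtain ⟨F, -, -, -, hmem, hE⟩ := hgen d ⟨hd, h d hd⟩
  obtain ⟨c, hc⟩ := exists_ne_zero_euclideanSpace hm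
  exact hE c hc ⟨hmem c, h _ (hmem c)⟩

/-- What genericity gives on a nonempty admissible class: SOME admissible datum has the property
(either the given one, or a member of the generic curve through it). -/
theorem exists_of_isChristodoulouGeneric {𝓓 : Set (InitialDataSet I Y)}
    {P : InitialDataSet I Y → Prop} {m : ℕ} (hm : 0 < m) (hne : 𝓓.Nonempty)
    (h : InitialDataSet.IsChristodoulouGeneric 𝓓 P m) : ∃ d ∈ 𝓓, P d := by
  by_contra hcon
  push Not at hcon
  exact not_isChristodoulouGeneric_of_forall_not hm hne hcon h

/-- Vacuity: an empty admissible class makes every property generic. -/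
theorem isChristodoulouGeneric_of_eq_empty {𝓓 : Set (InitialDataSet I Y)} (h𝓓 : 𝓓 = ∅)
    (P : InitialDataSet I Y → Prop) (m : ℕ) : InitialDataSet.IsChristodoulouGeneric 𝓓 P m := by
  intro d hd
  rw [h𝓓] at hd
  exact absurd hd.1 (Set.notMem_empty d)

/-- Codimension `0` is free for every property (constant family; the relative version of the
tree's `InitialDataSet.hasCodimAtLeast_zero`). -/
theorem isChristodoulouGeneric_zero (𝓓 : Set (InitialDataSet I Y)) (P : InitialDataSet I Y → Prop) :
    InitialDataSet.IsChristodoulouGeneric 𝓓 P 0 := by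
  intro d hd
  refine ⟨fun _ ↦ d, InitialDataSet.isSmoothDataFamily_const 0 d, rfl, ?_, fun _ ↦ hd.1, ?_⟩
  · intro a b _
    exact Subsingleton.elim a b
  · intro c hc
    exact absurd (Subsingleton.elim c 0) hc

/-- Genericity is monotone in the property (antitone in the exceptional set). -/
theorem isChristodoulouGeneric_mono {𝓓 : Set (InitialDataSet I Y)} {P Q : InitialDataSet I Y → Prop}
    (hPQ : ∀ d ∈ 𝓓, P d → Q d) {m : ℕ} (hP : InitialDataSet.IsChristodoulouGeneric 𝓓 P m) :
    InitialDataSet.IsChristodoulouGeneric 𝓓 Q m := by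
  intro d hd
  obtain ⟨F, hF, h0, hinj, hmem, hE⟩ := hP d ⟨hd.1, fun h ↦ hd.2 (hPQ d hd.1 h)⟩
  exact ⟨F, hF, h0, hinj, hmem, fun c hc hc' ↦ hE c hc ⟨hc'.1, fun h ↦ hc'.2 (hPQ _ hc'.1 h)⟩⟩

/-- The coordinate-axis embedding `ℝ¹ → ℝᵐ⁺¹`, `c ↦ c₀ e₀`. -/
def axisEmbed (m : ℕ) : EuclideanSpace ℝ (Fin 1) →L[ℝ] EuclideanSpace ℝ (Fin (m + 1)) :=
  ContinuousLinearMap.smulRight (EuclideanSpace.proj (0 : Fin 1))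
    (EuclideanSpace.single (0 : Fin (m + 1)) (1 : ℝ))

/-- `axisEmbed m c = c₀ • e₀`. -/
theorem axisEmbed_apply (m : ℕ) (c : EuclideanSpace ℝ (Fin 1)) :
    axisEmbed m c = (c 0) • EuclideanSpace.single (0 : Fin (m + 1)) (1 : ℝ) := rfl

/-- `axisEmbed m c = 0 ↔ c = 0`. -/
theorem axisEmbed_eq_zero_iff (m : ℕ) (c : EuclideanSpace ℝ (Fin 1)) : axisEmbed m c = 0 ↔ c = 0 := by
  constructor
  · intro h
    have h0 := congrArg (fun v : EuclideanSpace ℝ (Fin (m + 1)) ↦ v 0) h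
    simp [axisEmbed_apply] at h0
    ext i
    have hi : i = 0 := Subsingleton.elim i 0
    subst hi
    simpa using h0
  · rintro rfl
    exact map_zero _

/-- `axisEmbed m` is injective. -/
theorem axisEmbed_injective (m : ℕ) : Function.Injective (axisEmbed m) := by
  intro a b h
  have : axisEmbed m (a - b) = 0 := by rw [map_sub, h, sub_self]
  exact sub_eq_zero.mp ((axisEmbed_eq_zero_iff m _).mp this)

/-- **Codimension is monotone**: a set of codimension `≥ m + 1` inside `𝓓` has codimension `≥ 1`
(restrict the family to a coordinate axis). -/
theorem hasCodimAtLeastIn_one_of_succ {𝓓 𝓔 : Set (InitialDataSet I Y)} {m : ℕ}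
    (h : InitialDataSet.HasCodimAtLeastIn 𝓓 𝓔 (m + 1)) : InitialDataSet.HasCodimAtLeastIn 𝓓 𝓔 1 := by
  intro d hd
  obtain ⟨F, hF, h0, hinj, hmem, hE⟩ := h d hd
  have hι : ContMDiff (𝓘(ℝ, EuclideanSpace ℝ (Fin 1)).prod I) (𝓘(ℝ, EuclideanSpace ℝ (Fin (m + 1))).prod I)
      ∞ (fun p : EuclideanSpace ℝ (Fin 1) × Y ↦ (axisEmbed m p.1, p.2)) :=
    ((axisEmbed m).contMDiff.comp contMDiff_fst).prodMk contMDiff_snd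
  refine ⟨fun c ↦ F (axisEmbed m c), ⟨hF.1.comp hι, hF.2.comp hι⟩, ?_, ?_, fun c ↦ hmem _, ?_⟩
  · show F (axisEmbed m 0) = d
    rw [map_zero, h0]
  · exact hinj.comp (axisEmbed_injective m)
  · intro c hc
    exact hE _ (fun h ↦ hc ((axisEmbed_eq_zero_iff m c).mp h))

/-- Christodoulou genericity with codimension `m + 1` implies it with codimension `1`. -/
theorem isChristodoulouGeneric_one_of_succ {𝓓 : Set (InitialDataSet I Y)} {P : InitialDataSet I Y → Prop}
    {m : ℕ} (h : InitialDataSet.IsChristodoulouGeneric 𝓓 P (m + 1)) :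
    InitialDataSet.IsChristodoulouGeneric 𝓓 P 1 :=
  hasCodimAtLeastIn_one_of_succ h

end Genericity

/-- **Kill shape for the crux.** One `Σ` with a nonempty admissible class on which membership in
`settlingSet Σ` fails identically refutes `HonestFixedRadiusSettling`. -/
theorem not_crux_of_forall_not (X : Type) [TopologicalSpace X] [ChartedSpace E3 X]
    [IsManifold (𝓡 3) ∞ X] [T2Space X] [SecondCountableTopology X] [ConnectedSpace X]
    (hne : (admissibleVacuumData X).Nonempty) (h : ∀ D ∈ admissibleVacuumData X, D ∉ settlingSet X) :
    ¬ HonestFixedRadiusSettling :=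
  fun hS ↦ not_isChristodoulouGeneric_of_forall_not one_pos hne h (hS X)

/-- **Kill shape on `ℝ³`.** The admissible class of the Minkowski slice is nonempty (the tree's
`trivialData_mem_admissibleVacuumData`), so failure of `P` for EVERY admissible datum on `ℝ³` would
refute the crux. (`minkowski_mem_honestDevelopments` below shows such a failure would have to come
through maximality alone at the trivial datum.) -/
theorem not_crux_of_forall_not_slice
    (h : ∀ D ∈ admissibleVacuumData Minkowski.slice, D ∉ settlingSet Minkowski.slice) :
    ¬ HonestFixedRadiusSettling :=
  not_crux_of_forall_not Minkowski.slice ⟨_, trivialData_mem_admissibleVacuumData⟩ h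

/-! ### §2 Load-bearing parameter and the WCC content -/

/-- **The codimension `1` is the whole content**: with codimension `0` the statement holds outright. -/
theorem codim_zero (X : Type) [TopologicalSpace X] [ChartedSpace E3 X] [IsManifold (𝓡 3) ∞ X]
    [T2Space X] [SecondCountableTopology X] [ConnectedSpace X] :
    InitialDataSet.IsChristodoulouGeneric (admissibleVacuumData X) (· ∈ settlingSet X) 0 :=
  isChristodoulouGeneric_zero _ _

/-- **The crux is the weakest positive-codimension version**: a refutation of it refutes every
higher-codimension strengthening (and a proof of any of those proves it). -/
theorem not_codim_succ_of_not_crux (h : ¬ HonestFixedRadiusSettling) (m : ℕ) :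
    ¬ ∀ (X : Type) [TopologicalSpace X] [ChartedSpace E3 X] [IsManifold (𝓡 3) ∞ X] [T2Space X]
      [SecondCountableTopology X] [ConnectedSpace X],
      InitialDataSet.IsChristodoulouGeneric (admissibleVacuumData X) (· ∈ settlingSet X) (m + 1) :=
  fun hm ↦ h fun X _ _ _ _ _ _ ↦ isChristodoulouGeneric_one_of_succ (hm X)

/-- Vacuity on any `Σ` without admissible data (compact `Σ`, …): harmless, the crux quantifies
over every `Σ` including `ℝ³`. -/
theorem clause_of_eq_empty (X : Type) [TopologicalSpace X] [ChartedSpace E3 X]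
    [IsManifold (𝓡 3) ∞ X] [T2Space X] [SecondCountableTopology X] [ConnectedSpace X]
    (h : admissibleVacuumData X = ∅) (m : ℕ) :
    InitialDataSet.IsChristodoulouGeneric (admissibleVacuumData X) (· ∈ settlingSet X) m :=
  isChristodoulouGeneric_of_eq_empty h _ m

/-- **Negative lemma modulo ¬WCC.** The crux implies, by monotonicity of genericity, the typed weak
cosmic censorship statement "for every `Σ`, Christodoulou-generically in `admissibleVacuumData Σ` an
MGHD exists and every MGHD has complete `𝓘⁺` (sojourn form)" — verbatim (definitionally) the route
items `PhaseMixingCapture.WeakCosmicCensorshipMGHD` (`stmt-FinalStateConjecture-9952`) and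
`LapseTrumpetKID.WeakCosmicCensorship` (`stmt-FinalStateConjecture-10164`), written here over
`censoredSet` so that no other route file is imported. Hence any disproof of that statement kills
`HonestFixedRadiusSettling`. -/
theorem crux_false_of_not_wcc
    (h : ¬ ∀ (X : Type) [TopologicalSpace X] [ChartedSpace E3 X] [IsManifold (𝓡 3) ∞ X] [T2Space X]
      [SecondCountableTopology X] [ConnectedSpace X],
      InitialDataSet.IsChristodoulouGeneric (admissibleVacuumData X) (· ∈ censoredSet X) 1) :
    ¬ HonestFixedRadiusSettling := by
  intro hS
  apply h
  intro X _ _ _ _ _ _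
  exact isChristodoulouGeneric_mono (fun D _ hD ↦ settlingSet_subset_censoredSet hD) (hS X)

/-! ### §3 Monotonicity in `R₀` and the dispersive case -/

section Honesty

variable {𝓢 : Spacetime.{0} 4} {O : Set 𝓢.carrier} {k : ℕ}

/-- `honestCoreSet` grows with `R₀` (C1: `100M ≤ R₀ ≤ R₀'`; C2 asks fewer radii). -/
theorem honestCoreSet_mono {R₀ R₀' : ℝ} (hR : R₀ ≤ R₀') :
    honestCoreSet 𝓢 O k R₀ ⊆ honestCoreSet 𝓢 O k R₀' := by
  rintro d ⟨h1, h2, h3, h4⟩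
  exact ⟨fun i ↦ ⟨(h1 i).1, (h1 i).2.1.trans hR, (h1 i).2.2⟩,
    fun i ϱ τ₂ hϱ hτ ↦ h2 i ϱ τ₂ (hR.trans hϱ) hτ, h3, h4⟩

/-- `honestFarSet` grows with `R₀` (F3 is a sup over a smaller set). -/
theorem honestFarSet_mono {R₀ R₀' : ℝ} (hR : R₀ ≤ R₀') :
    honestFarSet 𝓢 O k R₀ ⊆ honestFarSet 𝓢 O k R₀' := by
  rintro d ⟨h1, h2, h3⟩
  refine ⟨h1, h2, fun i ↦ ?_⟩
  obtain ⟨T, hT⟩ := h3 i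
  refine ⟨T, le_trans (supCkENorm_mono (Set.image_mono ?_) _ _) hT⟩
  intro x hx
  exact ⟨hx.1, hR.trans hx.2.1, hx.2.2⟩

/-- Dispersive case: with no hole, `HonestCore` is just future-orientation of the flat chart. -/
theorem mem_honestCoreSet_iff_of_N_eq_zero (d : FinalStateDecomposition 𝓢 O k) (hN : d.N = 0)
    (R₀ : ℝ) :
    d ∈ honestCoreSet 𝓢 O k R₀ ↔
      ∀ y : d.flatDomain, d.τ₀ < y.1 0 →
        𝓢.timeOrientation.IsFutureDirected
          (mfderiv 𝓘(ℝ, E4) (𝓡 4) d.flatChart y (E4.basisVector 0)) := by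
  haveI : IsEmpty (Fin d.N) := hN ▸ Fin.isEmpty'
  simp only [honestCoreSet, mem_setOf_eq, IsEmpty.forall_iff, true_and]

/-- Dispersive case: with no hole, `HonestFar` is F1 plus closedness of the late flat slabs
`Φ({τ' ≤ x⁰})`, and it no longer depends on `R₀`. -/
theorem mem_honestFarSet_iff_of_N_eq_zero (d : FinalStateDecomposition 𝓢 O k) (hN : d.N = 0)
    (R₀ : ℝ) :
    d ∈ honestFarSet 𝓢 O k R₀ ↔
      (∀ τ₂ : ℝ, d.τ₀ < τ₂ → d.flatChart '' {y | d.τ₀ < y.1 0 ∧ y.1 0 < τ₂} ⊆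
          𝓢.metric.causalPast 𝓢.timeOrientation
            (d.flatChart '' (Minkowski.backgroundOn d.flatDomain).timeSlab τ₂)) ∧
        ∀ τ' : ℝ, d.τ₀ < τ' →
          closure (d.flatChart '' {y | τ' ≤ y.1 0}) ⊆ d.flatChart '' {y | τ' ≤ y.1 0} := by
  haveI : IsEmpty (Fin d.N) := hN ▸ Fin.isEmpty'
  simp only [honestFarSet, mem_setOf_eq, IsEmpty.forall_iff, and_true]

end Honesty

/-! ### §4 Existential content -/

/-- **Existential content of the crux.** `HonestFixedRadiusSettling` implies that SOME admissible
datum on `ℝ³` has a MAXIMAL vacuum Cauchy development which is honest (complete `𝓘⁺` and an honest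
`C⁴` decomposition of its exterior). No maximality theorem is in the tree, so every proof of the
crux must construct or import an MGHD. -/
theorem exists_isMaximal_of_crux (h : HonestFixedRadiusSettling) :
    ∃ D ∈ admissibleVacuumData Minkowski.slice, ∃ 𝒟 : VacuumCauchyDevelopment D,
      𝒟.IsMaximal ∧ 𝒟 ∈ honestDevelopments D := by
  obtain ⟨D, hD, ⟨𝒟, hmax⟩, hall⟩ := exists_of_isChristodoulouGeneric one_pos
    ⟨_, trivialData_mem_admissibleVacuumData⟩ (h Minkowski.slice)
  exact ⟨D, hD, 𝒟, hmax, hall 𝒟 hmax⟩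

end Summit.FinalStateConjecture.FinalStateConjecture.Theorems.HonestFixedRadiusSettling.Negative

end
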